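import Mathlib
import Summits.MatrixMultiplication.MatrixMultiplication.Theorems.AbelianSTPPSieveVP

/-!
# Tightness of crux `ShapeExclusionVP337`: the vP shape census for T_E FAILS at order 338

The route target order 337 is the exact ceiling of the instrument: the list `(7,5,5), (6,6,6), (6,6,6), (6,6,6)` is vP-admissible at
`M = 338` (every clause of `SieveAdmissible`, all three forms of U11-G; 338 is composite so U11-P is vacuous) and beats `5/2`
(`3·216^{5/6} + 175^{5/6} = 338.53… > 338`).  Hence the strengthening of the crux from `M ≤ 337` to `M ≤ 338` is FALSE
(`shapeExclusionVP_false_at_338`) — a refuted strengthening in the sense of the crux protocol (the crux is typed at the sharp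
threshold, not at a hand-picked one).  Source of the witness: census of record, lineage A′+G, smallest FEASIBLE T_E row (M = 338,
HOME/mm-stpp-plan/calc/vP-lineageA/merged_A.jsonl).  Cell mm-stpp, planner gen 7, 2026-08-26.
WHAT THIS IS NOT: no STPP is claimed to exist with these shapes (the census only fails to exclude it); no ω statement.
-/

-- single-conjunct summit: the mandated namespace repeats `MatrixMultiplication`.
set_option linter.dupNamespace false

namespace Summit.MatrixMultiplication.MatrixMultiplication.Theorems

namespace AbelianSTPPCensusVP

open Finset

/-- The witness list at order 338: `(7,5,5), (6,6,6)³`. -/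
def w338 : List (ℕ × ℕ × ℕ) := [(7,5,5), (6,6,6), (6,6,6), (6,6,6)]

/-- first sizes -/
def wa : Fin 4 → ℕ := ![7, 6, 6, 6]
/-- middle sizes -/
def wb : Fin 4 → ℕ := ![5, 6, 6, 6]
/-- last sizes -/
def wc : Fin 4 → ℕ := ![5, 6, 6, 6]

/-- `q ≤ x^{5/6}` from the integer-checkable `q⁶ ≤ x⁵`. -/
theorem le_rpow_five_sixths {x q : ℝ} (hx : 0 ≤ x) (hq : 0 ≤ q) (h : q ^ 6 ≤ x ^ 5) :
    q ≤ x ^ ((5 : ℝ) / 6) := by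
  have h1 : (q ^ 6) ^ ((6 : ℝ)⁻¹) = q := by
    have := Real.pow_rpow_inv_natCast hq (show (6 : ℕ) ≠ 0 by norm_num)
    simpa using this
  have h2 : x ^ ((5 : ℝ) / 6) = (x ^ 5) ^ ((6 : ℝ)⁻¹) := by
    rw [show ((5 : ℝ) / 6) = (5 : ℝ) * (6 : ℝ)⁻¹ by norm_num, Real.rpow_mul hx]
    congr 1
    exact_mod_cast Real.rpow_natCast x 5
  rw [← h1, h2]
  exact Real.rpow_le_rpow (by positivity) h (by norm_num)

/-- The witness beats `5/2` at order 338: `Σ V^{5/6} = 338.53… > 338`. -/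
theorem w338_beats : Beats (5 / 2) 338 wa wb wc := by
  unfold Beats
  have hA : (88.18 : ℝ) ≤ (216 : ℝ) ^ ((5 : ℝ) / 6) :=
    le_rpow_five_sixths (by norm_num) (by norm_num) (by norm_num)
  have hB : (73.99 : ℝ) ≤ (175 : ℝ) ^ ((5 : ℝ) / 6) :=
    le_rpow_five_sixths (by norm_num) (by norm_num) (by norm_num)
  have hexp : ((5 : ℝ) / 2 / 3) = (5 : ℝ) / 6 := by norm_num
  simp only [Fin.sum_univ_four, shapeVol, wa, wb, wc, hexp]
  simp only [Matrix.cons_val_zero, Matrix.cons_val_one, Matrix.cons_val]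
  norm_num
  linarith

/-- The witness is vP-admissible at order 338. -/
theorem w338_admissible : SieveAdmissibleVP 338 wa wb wc := by
  refine ⟨?_, ?_, fun h => absurd h (by norm_num)⟩
  · -- SieveAdmissible: decidable clauses by `decide`; the U14 tightness implications are vacuous (no `u14Sum` equals 338)
    refine ⟨by decide, by decide, by decide, by decide, by decide, ?_, ?_⟩
    · intro l
      refine ⟨by revert l; decide, fun h => absurd h (by revert l; decide), by revert l; decide,
        fun h => absurd h (by revert l; decide), by revert l; decide, fun h => absurd h (by revert l; decide)⟩
    · intro l
      refine ⟨fun h _ => absurd h (by revert l; decide), fun h _ => absurd h (by revert l; decide),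
        fun h _ => absurd h (by revert l; decide)⟩
  · -- U11G, three forms: bounded quantifier over `t`, decidable
    refine ⟨?_, ?_, ?_⟩ <;> (unfold U11GFormB; decide)

/-- **Refuted strengthening**: the crux with `337` replaced by `338` is false. -/
theorem shapeExclusionVP_false_at_338 :
    ¬ (∀ (N M : ℕ) (a b c : Fin N → ℕ), 2 ≤ N → M ≤ 338 → SieveAdmissibleVP M a b c → ¬ Beats (5 / 2) M a b c) :=
  fun h => h 4 338 wa wb wc (by norm_num) le_rfl w338_admissible w338_beats

end AbelianSTPPCensusVP

end Summit.MatrixMultiplication.MatrixMultiplication.Theorems
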